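import Literature.Topology.FourManifolds.PolarCap
import HarnessLib

/-!
# Preparations for the headless sub-ball: a compactness lemma and the lid near the straight rim

Topic `Literature/Topology/FourManifolds`; Step H of the second half of the capped-ball step of
the fact seat of Alexander's theorem
(`provefact-Literature.Topology.FourManifolds.SphereEmbedding.schoenflies_exists_ball`,
Schultens (2014), Thm. 3.2.5).  **Everything here is proved; no definitions, no named facts.**

* §1 `CappedBallLid.exists_pos_forall_mem_of_isCompact` — if an open set contains the zero set
  of a continuous `F` inside a compact `K`, it contains `K ∩ {|F| ≤ δ}` for some `δ > 0`.
* §2 The lid function near the straight part of the rim: for `0 < s ≤ 1/8`, on the slab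
  `Ω = {hsq < (1 + 2s)², -2s < x₂ < -3s/4}` the lid function of `CappedBallLid.lean` has the
  sign of `hsq - (1 + s)²` (`lidFun_sign_iff_of_mem_slab`); above the apex (`x₂ > s`) it is
  positive — use `CappedBallLid.lidFun_pos_of_lt_coord_two` (`CappedBallLid.lean`; the former
  in-file restatement `lidFun_pos_of_apex_lt` was removed as a duplicate, dedup-00879).
* §3 Polar description of the same slab about `p₀ = (0, 0, -5s)`: with `d = 4s`, `c = s`,
  `c_h = 1/8`, `ρ₁ = 1 + s` one has `vc ≥ s`, `R < 2`, `T̃ = 4s / vc`,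
  `R ≤ g̃ ↔ hsq ≤ (1 + s)²`, `R ≤ T̃ ↔ x₂ ≤ -s` (`PolarCap.lean`).

## References
* J. Schultens, *Introduction to 3-Manifolds*, GSM 151 (2014), Thm. 3.2.5.
-/

open scoped RealInnerProductSpace Topology ContDiff
open Set Filter Metric Function

noncomputable section

namespace Literature.Topology.FourManifolds

namespace CappedBallLid

/-! ### §1 A compactness lemma -/

/-- **Thin collars lie in open neighbourhoods of the zero set.**  If `K` is compact, `F`
continuous and the open set `U` contains every zero of `F` in `K`, then for some `δ > 0` it
contains every point of `K` with `|F| ≤ δ`. [folklore] -/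
theorem exists_pos_forall_mem_of_isCompact {X : Type*} [TopologicalSpace X] {K U : Set X}
    (hK : IsCompact K) {F : X → ℝ} (hF : Continuous F) (hU : IsOpen U)
    (h : ∀ x ∈ K, F x = 0 → x ∈ U) :
    ∃ δ : ℝ, 0 < δ ∧ ∀ x ∈ K, |F x| ≤ δ → x ∈ U := by
  have hc : IsCompact (K \ U) := hK.diff hU
  by_cases hne : (K \ U).Nonempty
  · obtain ⟨x₀, hx₀, hmin⟩ := hc.exists_isMinOn hne (continuous_abs.comp hF).continuousOn
    have hpos : 0 < |F x₀| := abs_pos.2 fun h0 => hx₀.2 (h x₀ hx₀.1 h0)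
    refine ⟨|F x₀| / 2, by linarith, fun x hx hFx => ?_⟩
    by_contra hxU
    have h' : |F x₀| ≤ |F x| := hmin ⟨hx, hxU⟩
    linarith
  · exact ⟨1, one_pos, fun x hx _ => by_contra fun hxU => hne ⟨x, hx, hxU⟩⟩

/-! ### §2 The lid near the straight rim -/

variable {P : ℝ → ℝ} {s : ℝ}

/-- On the slab `-2s < x₂ < -3s/4` (`0 < s ≤ 1/8`) the top argument is below the rim argument
by more than the width: `topFun ≤ rimFun - s/8` whenever `hsq ≥ (1+s)² - s/4`. [folklore] -/
theorem topFun_le_rimFun_of_mem_slab (hs : 0 < s) (hs1 : s ≤ 1 / 8) {x : (EuclideanSpace ℝ (Fin 3))}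
    (hz1 : -2 * s < x 2) (hz2 : x 2 < -(3 * s / 4)) (hh : (1 + s) ^ 2 - s / 4 ≤ hsq x) :
    topFun s x ≤ rimFun s x - s / 8 := by
  have hr : rimRadius s (x 2) = s := rimRadius_eq_self hs hz1.le
  unfold topFun rimFun
  rw [hr]
  have h8 : s ^ 2 ≤ s / 8 := by nlinarith
  have h64 : s ^ 3 ≤ s / 64 := by nlinarith
  nlinarith [hsq_nonneg x, mul_le_mul_of_nonneg_left hh (by linarith : (0:ℝ) ≤ 1 - s)]

/-- On that part of the slab the lid function *is* the straight rim function
`hsq - (1+s)²`. [folklore] -/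
theorem lidFun_eq_of_mem_slab (hP1 : ∀ t, 1 ≤ t → P t = t) (hs : 0 < s) (hs1 : s ≤ 1 / 8)
    {x : (EuclideanSpace ℝ (Fin 3))} (hz1 : -2 * s < x 2) (hz2 : x 2 < -(3 * s / 4)) (hh : (1 + s) ^ 2 - s / 4 ≤ hsq x) :
    lidFun P s x = hsq x - (1 + s) ^ 2 := by
  rw [lidFun_eq_rimFun hP1 hs (topFun_le_rimFun_of_mem_slab hs hs1 hz1 hz2 hh)]
  unfold rimFun
  rw [rimRadius_eq_self hs hz1.le]

/-- Inside the slab and well inside the rim (`hsq ≤ (1+s)² - s/4`) the lid function is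
negative. [folklore] -/
theorem lidFun_neg_of_mem_slab (hPle : ∀ t, P t ≤ max 0 t + 1) (hs : 0 < s) (hs1 : s ≤ 1 / 8)
    {x : (EuclideanSpace ℝ (Fin 3))} (hz1 : -2 * s < x 2) (hz2 : x 2 < -(3 * s / 4)) (hh : hsq x ≤ (1 + s) ^ 2 - s / 4) :
    lidFun P s x < 0 := by
  have hr : rimRadius s (x 2) = s := rimRadius_eq_self hs hz1.le
  have h8 : s ^ 2 ≤ s / 8 := by nlinarith
  have h64 : s ^ 3 ≤ s / 64 := by nlinarith
  have h1 : topFun s x ≤ -(s / 8) - s / 8 := by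
    unfold topFun
    have : s * hsq x ≤ s * ((1 + s) ^ 2 - s / 4) := mul_le_mul_of_nonneg_left hh hs.le
    nlinarith [hsq_nonneg x]
  have h2 : rimFun s x ≤ -(s / 8) - s / 8 := by
    unfold rimFun; rw [hr]; nlinarith
  have := SmoothMax.smax_le_max_add hPle (show 0 < s / 8 by positivity) (topFun s x) (rimFun s x)
  unfold lidFun
  have hm : max (topFun s x) (rimFun s x) ≤ -(s / 8) - s / 8 := max_le h1 h2
  linarith

/-- **Sign of the lid function on the slab**: it is the sign of `hsq - (1+s)²`. [folklore] -/
theorem lidFun_sign_iff_of_mem_slab (hP1 : ∀ t, 1 ≤ t → P t = t) (hPle : ∀ t, P t ≤ max 0 t + 1)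
    (hs : 0 < s) (hs1 : s ≤ 1 / 8) {x : (EuclideanSpace ℝ (Fin 3))} (hz1 : -2 * s < x 2) (hz2 : x 2 < -(3 * s / 4)) :
    (lidFun P s x < 0 ↔ hsq x < (1 + s) ^ 2) ∧ (lidFun P s x = 0 ↔ hsq x = (1 + s) ^ 2) ∧
      (0 < lidFun P s x ↔ (1 + s) ^ 2 < hsq x) := by
  by_cases hh : (1 + s) ^ 2 - s / 4 ≤ hsq x
  · rw [lidFun_eq_of_mem_slab hP1 hs hs1 hz1 hz2 hh]
    exact ⟨sub_neg, sub_eq_zero, sub_pos⟩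
  · push Not at hh
    have hneg := lidFun_neg_of_mem_slab hPle hs hs1 hz1 hz2 hh.le
    refine ⟨⟨fun _ => by linarith, fun _ => hneg⟩, ⟨fun h => by linarith, fun h => by linarith⟩,
      ⟨fun h => by linarith, fun h => by linarith⟩⟩

/-- **Laterally**: if `lidFun x ≤ 0` then `hsq x ≤ (1+s)²` (`s > 0`). [folklore] -/
theorem hsq_le_of_lidFun_nonpos (hPge : ∀ t, max 0 t ≤ P t) (hs : 0 < s) {x : (EuclideanSpace ℝ (Fin 3))}
    (h : lidFun P s x ≤ 0) : hsq x ≤ (1 + s) ^ 2 := by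
  have := SmoothMax.max_le_smax hPge (show 0 < s / 8 by positivity) (topFun s x) (rimFun s x)
  have hb : rimFun s x ≤ 0 := le_trans (le_max_right _ _) (this.trans h)
  unfold rimFun at hb
  have hr0 := rimRadius_nonneg hs (x 2)
  have hr1 := rimRadius_le hs (x 2)
  nlinarith

/-! ### §3 The polar description of the slab about `p₀ = (0, 0, -5s)` -/

/-- On the slab, with `z₀ = -5s`: `x₂ - z₀ > 3s`, `R < 2`, `vc > s`. [folklore] -/
theorem slab_polar_bounds (hs : 0 < s) (hs1 : s ≤ 1 / 8) {x : (EuclideanSpace ℝ (Fin 3))} (hh : hsq x < (1 + 2 * s) ^ 2)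
    (hz1 : -2 * s < x 2) (hz2 : x 2 < 2 * s) :
    x ≠ axisPt (-5 * s) ∧ 3 * s < x 2 - -5 * s ∧ prad (-5 * s) x < 2 ∧ s < vcos (-5 * s) x := by
  have hx : x ≠ axisPt (-5 * s) := ne_axisPt_of_lt (by linarith)
  have hR := prad_pos hx
  have h3 : 3 * s < x 2 - -5 * s := by linarith
  have hR2 : prad (-5 * s) x < 2 := by
    have h := prad_sq (-5 * s) x
    have h49 : (x 2 - -5 * s) ^ 2 < 49 / 64 := by nlinarith
    have h12 : (1 + 2 * s) ^ 2 ≤ 25 / 16 := by nlinarith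
    have : prad (-5 * s) x ^ 2 < 4 := by rw [h]; nlinarith
    nlinarith [hR.le]
  refine ⟨hx, h3, hR2, ?_⟩
  unfold vcos
  rw [lt_div_iff₀ hR]
  nlinarith

/-- **Cylinder test on the slab**: `R ≤ g̃ ↔ hsq ≤ (1+s)²` and `R < g̃ ↔ hsq < (1+s)²`
(`z₀ = -5s`, `ρ₁ = 1 + s`, cap `1/8`). [folklore] -/
theorem prad_le_cylPolar_iff_of_mem_slab (hs : 0 < s) (hs1 : s ≤ 1 / 8) {x : (EuclideanSpace ℝ (Fin 3))}
    (hh : hsq x < (1 + 2 * s) ^ 2) (hz1 : -2 * s < x 2) (hz2 : x 2 < 2 * s) :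
    (prad (-5 * s) x ≤ cylPolar (-5 * s) (1 + s) (1 / 8) x ↔ hsq x ≤ (1 + s) ^ 2) ∧
    (prad (-5 * s) x < cylPolar (-5 * s) (1 + s) (1 / 8) x ↔ hsq x < (1 + s) ^ 2) := by
  obtain ⟨hx, h3, hR2, hvc⟩ := slab_polar_bounds hs hs1 hh hz1 hz2
  have hR := prad_pos hx
  by_cases hc : 1 / 8 ≤ hsin2 (-5 * s) x
  · exact prad_le_cylPolar_iff (by linarith) (by norm_num) hx hc
  · push Not at hc
    -- near the axis: `hsq < R²/8 < 1/2`, and `g̃ ≥ (1+s)/√(1/8) > 2 > R`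
    have hhsq : hsq x < 1 / 2 := by
      unfold hsin2 at hc
      rw [div_lt_iff₀ (by positivity)] at hc
      nlinarith
    have hcap : capFun (1 / 8) (hsin2 (-5 * s) x) ≤ 1 / 8 := capFun_le hc.le
    have hcpos : 0 < capFun (1 / 8) (hsin2 (-5 * s) x) := capFun_pos (by norm_num) _
    have hg : 2 < cylPolar (-5 * s) (1 + s) (1 / 8) x := by
      unfold cylPolar
      rw [lt_div_iff₀ (Real.sqrt_pos.2 hcpos)]
      have : Real.sqrt (capFun (1 / 8) (hsin2 (-5 * s) x)) ≤ Real.sqrt (1 / 8) := Real.sqrt_le_sqrt hcap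
      have h8 : Real.sqrt (1 / 8) < 1 / 2 := by
        rw [Real.sqrt_lt' (by norm_num)]; norm_num
      nlinarith
    have h1 : hsq x < (1 + s) ^ 2 := by nlinarith
    exact ⟨⟨fun _ => h1.le, fun _ => by linarith⟩, ⟨fun _ => h1, fun _ => by linarith⟩⟩

/-- **Plane test on the slab**: `R ≤ T̃ ↔ x₂ ≤ -s` and `R < T̃ ↔ x₂ < -s` (`z₀ = -5s`, `d = 4s`,
cap `s`). [folklore] -/
theorem prad_le_planePolar_iff_of_mem_slab (hs : 0 < s) (hs1 : s ≤ 1 / 8) {x : (EuclideanSpace ℝ (Fin 3))}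
    (hh : hsq x < (1 + 2 * s) ^ 2) (hz1 : -2 * s < x 2) (hz2 : x 2 < 2 * s) :
    (prad (-5 * s) x ≤ planePolar (-5 * s) (4 * s) s x ↔ x 2 ≤ -s) ∧
    (prad (-5 * s) x < planePolar (-5 * s) (4 * s) s x ↔ x 2 < -s) := by
  obtain ⟨hx, h3, hR2, hvc⟩ := slab_polar_bounds hs hs1 hh hz1 hz2
  have h := prad_le_planePolar_iff (d := 4 * s) hs hx hvc.le
  constructor
  · rw [h.1]; constructor <;> intro <;> linarith
  · rw [h.2]; constructor <;> intro <;> linarith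

/-- On the slab the plane graph is `4s / vc` exactly and `T̃ - R = (-s - x₂)/vc`. [folklore] -/
theorem planePolar_sub_prad_of_mem_slab (hs : 0 < s) (hs1 : s ≤ 1 / 8) {x : (EuclideanSpace ℝ (Fin 3))}
    (hh : hsq x < (1 + 2 * s) ^ 2) (hz1 : -2 * s < x 2) (hz2 : x 2 < 2 * s) :
    planePolar (-5 * s) (4 * s) s x - prad (-5 * s) x = (-s - x 2) / vcos (-5 * s) x := by
  obtain ⟨hx, h3, hR2, hvc⟩ := slab_polar_bounds hs hs1 hh hz1 hz2
  have hR := prad_pos hx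
  have hv : 0 < vcos (-5 * s) x := by linarith
  have hT : planePolar (-5 * s) (4 * s) s x = 4 * s / vcos (-5 * s) x := by
    unfold planePolar; rw [capFun_eq_self hs hvc.le]
  rw [hT, eq_div_iff hv.ne', sub_mul, div_mul_cancel₀ _ hv.ne']
  have hRv : prad (-5 * s) x * vcos (-5 * s) x = x 2 - -5 * s := by
    unfold vcos; rw [mul_div_cancel₀ _ hR.ne']
  linarith

end CappedBallLid

end Literature.Topology.FourManifolds

end
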